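import Summits.AtomisticToContinuum.Crystallization.Theses.HullExactificationCascade

/-!
# Route HullExactificationCascade — item 12091 `HullDefectDensityZero` (support F₀)

Item `stmt-AtomisticToContinuum-12091`: for fixed `a, h ≠ 0` and `S ⊆ ℝ³`, the three hypotheses
(i) local lower bound `2e*·n + κ(η)·D_η − C(L+1)² ≤ Σ` on every ball `B_L(c)`, `L ≥ 0`
  (`e* = e(hcpPeriodicConfiguration a h)`, `n = #(S ∩ B_L(c))`, `D_η = #{η-bad points}`,
  `Σ` = the double site-energy sum),
(ii) bulk upper bound `Σ ≤ 2ℓ·n + εL³` for `L ≥ L₀(ε)` (`ℓ = liminf E(N)/N`),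
(iii) `ℓ ≤ e*`,
give `∀ η θ > 0 ∃ L₀ ∀ L ≥ L₀ ∀ c, D_η(c, L) ≤ θL³`.

PROOF (pure real bookkeeping, no geometry, no counting — the cardinalities and the sum enter only as
real numbers with `n ≥ 0`): `κ·D ≤ Σ − 2e*·n + C(L+1)² ≤ 2(ℓ − e*)·n + εL³ + C(L+1)² ≤ εL³ + C(L+1)²`;
take `ε := κθ/2` and `L ≥ max (L₀(ε)) (max 1 (16·max(C,0)/(κθ)))`, so that
`C(L+1)² ≤ 4·max(C,0)·L² ≤ (κθ/2)L³`; then `κ·D ≤ κθL³` and `κ > 0`.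
-/

namespace Summit.AtomisticToContinuum.Crystallization.Theorems

/-- Real-algebra core of item 12091: if `2en + κD − C(L+1)² ≤ T ≤ 2ℓn + (κθ/2)L³` with `κ, θ > 0`,
`n ≥ 0`, `ℓ ≤ e`, `L ≥ 1` and `16·max(C,0)/(κθ) ≤ L`, then `D ≤ θL³`. -/
theorem hullDefectDensityZero_bookkeeping {κ θ C n D T ℓ e L : ℝ}
    (hlow : 2 * e * n + κ * D - C * (L + 1) ^ 2 ≤ T)
    (hup : T ≤ 2 * ℓ * n + κ * θ / 2 * L ^ 3)
    (hκ : 0 < κ) (hθ : 0 < θ) (hn : 0 ≤ n) (hℓ : ℓ ≤ e) (hL1 : 1 ≤ L)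
    (hLC : 16 * max C 0 / (κ * θ) ≤ L) : D ≤ θ * L ^ 3 := by
  have hκθ : 0 < κ * θ := mul_pos hκ hθ
  have hM0 : 0 ≤ max C 0 := le_max_right _ _
  have hL0 : 0 ≤ L := le_trans zero_le_one hL1
  have h1 : 2 * ℓ * n ≤ 2 * e * n := by nlinarith
  have h2 : C * (L + 1) ^ 2 ≤ max C 0 * (L + 1) ^ 2 :=
    mul_le_mul_of_nonneg_right (le_max_left C 0) (sq_nonneg _)
  have h3 : (L + 1) ^ 2 ≤ 4 * L ^ 2 := by nlinarith
  have h4 : max C 0 * (L + 1) ^ 2 ≤ max C 0 * (4 * L ^ 2) := mul_le_mul_of_nonneg_left h3 hM0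
  have h5 : 16 * max C 0 ≤ κ * θ * L := by
    have h := (div_le_iff₀ hκθ).mp hLC
    linarith
  have h6 : max C 0 * (4 * L ^ 2) ≤ κ * θ / 2 * L ^ 3 := by
    have h5' : 16 * max C 0 * L ^ 2 ≤ κ * θ * L * L ^ 2 :=
      mul_le_mul_of_nonneg_right h5 (sq_nonneg L)
    have hML : 0 ≤ max C 0 * L ^ 2 := mul_nonneg hM0 (sq_nonneg L)
    nlinarith [h5', hML]
  have h7 : κ * D ≤ κ * (θ * L ^ 3) := by nlinarith [hlow, hup, h1, h2, h4, h6]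
  exact le_of_mul_le_mul_left h7 hκ

/-- **Item 12091 `HullDefectDensityZero`** (route `HullExactificationCascade`, support F₀, closed by
name): the B-inequality, the E-inequality and `liminf E(N)/N ≤ e(hcp a h)` for a fixed `S` give
zero density of `η`-bad points uniformly over balls: `∀ η θ > 0 ∃ L₀ ∀ L ≥ L₀ ∀ c, #bad_η ≤ θL³`.
Instantiation of `hullDefectDensityZero_bookkeeping` with `ε := κθ/2` and
`L₀ := max L₀(ε) (max 1 (16·max(C,0)/(κθ)))`; the set-builder cardinalities and the double `tsum`
are read off the hypotheses by unification and never unfolded. -/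
theorem hullDefectDensityZero_proof :
    Summit.AtomisticToContinuum.Crystallization.Theses.HullExactificationCascade.HullDefectDensityZero := by
  unfold Summit.AtomisticToContinuum.Crystallization.Theses.HullExactificationCascade.HullDefectDensityZero
  intro a h ha hh S hB hE hle η hη θ hθ
  obtain ⟨κ, hκ, C, hBall⟩ := hB η hη
  obtain ⟨L₁, hL₁⟩ := hE (κ * θ / 2) (by positivity)
  refine ⟨max L₁ (max 1 (16 * max C 0 / (κ * θ))), fun L hL c => ?_⟩
  have hL₁L : L₁ ≤ L := le_trans (le_max_left _ _) hL
  have h1L : 1 ≤ L := le_trans (le_trans (le_max_left _ _) (le_max_right _ _)) hL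
  have hCL : 16 * max C 0 / (κ * θ) ≤ L :=
    le_trans (le_trans (le_max_right _ _) (le_max_right _ _)) hL
  exact hullDefectDensityZero_bookkeeping (hBall c L (le_trans zero_le_one h1L)) (hL₁ L hL₁L c)
    hκ hθ (Nat.cast_nonneg _) hle h1L hCL

end Summit.AtomisticToContinuum.Crystallization.Theorems
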